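import Summits.MatrixMultiplication.MatrixMultiplication.Theorems.SoloBlindConjEReduction

/-!
# A primitive equality case of Conjecture E in rank 5 (kernel witness)

Sub-programme (K₃), H-good half (Conjecture E: `soloBlindMass h S τ ≤ 1/2` for zero-sum-free `h` and H-good `τ`).
The exact reductions proved so far remove equality cases that have a VALUE (member of size `1`), a PAIR (size `2`),
a TRIANGLE of three `3`-members, or a CONE POINT (an index lying in every representation); the binary lifts
(`SoloBlindBinaryLift`) give equality cases with no member below any prescribed size.  This file certifies the
smallest equality case outside all of these: on the nine points
`e₁, e₂, e₃, e₄, e₅, e₁+e₂, e₁+e₃, e₂+e₃+e₄, 2e₂+e₃+e₅` of `𝔽₃⁵` with target `τ = e₁+e₃+e₄+e₅` the representations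
are `{e₄, e₅, e₁+e₃}`, `{e₄, e₁+e₂, 2e₂+e₃+e₅}`, `{e₁, e₂, e₄, 2e₂+e₃+e₅}`, `{e₁, e₃, e₄, e₅}`,
`{e₂, e₅, e₁+e₂, e₂+e₃+e₄}`, `{e₃, e₁+e₃, e₂+e₃+e₄, 2e₂+e₃+e₅}` (sizes `3,3,4,4,4,4`, mass `2/8 + 4/16 = 1/2`):
zero-sum free, H-good, pair-free and value-free, exactly two members of size `3`, and no index common to all
members (`soloBlind_conjE_tight_core_rank5`).  All proofs are kernel evaluations (`decide +kernel`).
-/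

namespace Summit.MatrixMultiplication.MatrixMultiplication.Theorems

open Finset

/-- The nine-point core configuration of rank 5 as a table on `Fin 9`. -/
def soloBlindCoreFive : Fin 9 → (Fin 5 → ZMod 3) :=
  ![![1,0,0,0,0], ![0,1,0,0,0], ![0,0,1,0,0], ![0,0,0,1,0], ![0,0,0,0,1],
    ![1,1,0,0,0], ![1,0,1,0,0], ![0,1,1,1,0], ![0,2,1,0,1]]

/-- Its target `τ = e₁ + e₃ + e₄ + e₅`. -/
def soloBlindCoreFiveTarget : Fin 5 → ZMod 3 := ![1,0,1,1,1]

/-- The core configuration is zero-sum free. -/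
theorem soloBlindCoreFive_zsf :
    ∀ T ⊆ (Finset.univ : Finset (Fin 9)), T.Nonempty → ∑ i ∈ T, soloBlindCoreFive i ≠ 0 := by
  decide +kernel

/-- Its target is H-good. -/
theorem soloBlindCoreFive_hgood :
    ∀ T ⊆ (Finset.univ : Finset (Fin 9)),
      ∑ i ∈ T, soloBlindCoreFive i ≠ soloBlindCoreFiveTarget + soloBlindCoreFiveTarget := by
  decide +kernel

/-- It is pair-free and value-free: every representation has at least `3` elements. -/
theorem soloBlindCoreFive_minsize :
    ∀ T ⊆ (Finset.univ : Finset (Fin 9)),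
      ∑ i ∈ T, soloBlindCoreFive i = soloBlindCoreFiveTarget → 3 ≤ T.card := by
  decide +kernel

/-- It has exactly two representations of size `3` (so it is not a triangle configuration). -/
theorem soloBlindCoreFive_two_triples :
    ((Finset.univ : Finset (Fin 9)).powerset.filter
      (fun T => ∑ i ∈ T, soloBlindCoreFive i = soloBlindCoreFiveTarget ∧ T.card = 3)).card = 2 := by
  decide +kernel

/-- It is not a cone: no index lies in every representation. -/
theorem soloBlindCoreFive_no_apex :
    ∀ j : Fin 9, ∃ T : Finset (Fin 9),
      ∑ i ∈ T, soloBlindCoreFive i = soloBlindCoreFiveTarget ∧ j ∉ T := by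
  decide +kernel

/-- Its Kraft mass is exactly `1/2`. -/
theorem soloBlindCoreFive_mass :
    soloBlindMass soloBlindCoreFive Finset.univ soloBlindCoreFiveTarget = 1 / 2 := by
  decide +kernel

/-- A PRIMITIVE EQUALITY CASE OF CONJECTURE E IN RANK 5: zero-sum free, H-good, all members of size `≥ 3`,
exactly two members of size `3`, no cone point, mass exactly `1/2`. -/
theorem soloBlind_conjE_tight_core_rank5 :
    ∃ (h : Fin 9 → (Fin 5 → ZMod 3)) (τ : Fin 5 → ZMod 3),
      (∀ T ⊆ (Finset.univ : Finset (Fin 9)), T.Nonempty → ∑ i ∈ T, h i ≠ 0) ∧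
      (∀ T ⊆ (Finset.univ : Finset (Fin 9)), ∑ i ∈ T, h i ≠ τ + τ) ∧
      (∀ T ⊆ (Finset.univ : Finset (Fin 9)), ∑ i ∈ T, h i = τ → 3 ≤ T.card) ∧
      ((Finset.univ : Finset (Fin 9)).powerset.filter
          (fun T => ∑ i ∈ T, h i = τ ∧ T.card = 3)).card = 2 ∧
      (∀ j : Fin 9, ∃ T : Finset (Fin 9), ∑ i ∈ T, h i = τ ∧ j ∉ T) ∧
      soloBlindMass h Finset.univ τ = 1 / 2 :=
  ⟨soloBlindCoreFive, soloBlindCoreFiveTarget, soloBlindCoreFive_zsf, soloBlindCoreFive_hgood,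
    soloBlindCoreFive_minsize, soloBlindCoreFive_two_triples, soloBlindCoreFive_no_apex,
    soloBlindCoreFive_mass⟩

end Summit.MatrixMultiplication.MatrixMultiplication.Theorems
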